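import Mathlib
import HarnessLib
import HarnessLib.Audit
import Summits.AtomisticToContinuum.Statement
import HarnessLib.Audit.Status.Attr

/-!
Route: VitaliAmplitudeTransfer

DORMANT since 2026-08-23T05:14:32Z (reconciler: no traction for 5.9 d (last activity item-evidence-added at 2026-08-17T06:25:25Z); parked, not closed — `ledger route dormant route-AtomisticToContinuum-VitaliAmplitudeTransfer --off` to r) — unstaffed, not closed; items shared with open routes are served there. `ledger route dormant <id> --off` reactivates.

# Route VitaliAmplitudeTransfer — N-uniform analyticity in the local-Gibbs tilt amplitude plus a
near-equilibrium anchor give Euler before the shock by Vitali (conforming successor of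
AmplitudeAnalyticity)

CONFORMING SUCCESSOR (D-0027 §2.1) of route-AtomisticToContinuum-AmplitudeAnalyticity (opened
2026-08-15T11:41Z, retired 13:38Z
`not-a-thesis`: no deciding theorem, its Assembly stopped at the Literature decl): same mechanism —
card amplitude-analyticity-transfer in the
economical form (A1)+(B1') named by its triage — with the four cruxes re-filed unchanged, the old
support `VitaliPropagation` DROPPED because
Vitali's convergence theorem is now PROVED in the library
(`Literature.Analysis.Complex.exists_tendstoLocallyUniformlyOn_of_frequently_tendsto`,
with Montel `Complex.exists_strictMono_tendstoLocallyUniformlyOn_of_norm_le`), and the transfer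
bookkeeping filed as the typed glue
`AmplitudeTransfer`, so that the deciding theorem `closes` is pure logic and concludes
`HydrodynamicLimit` itself.
It suffices to show X = A ∧ B ∧ V ∧ C′. Embed the datum in a one-parameter family of local Gibbs
laws ψ_δ, δ ∈ [0,1], from global
equilibrium (δ = 0) to the target profiles (δ = 1), pre-shock on [0,T'). A
(UniformAmplitudeAnalyticity): along paths of profiles
real-analytic in (δ,x), the time-t MEANS m_N(δ) = E_ψ_δ[∫ w dμ^emp(Φ_t z)] of one-body empirical
observables extend, uniformly in N, to
holomorphic functions bounded by one constant on a fixed complex neighbourhood of [0,1] ("no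
dynamical Lee–Yang zeros before the shock").
B (NearEquilibriumLimit): the hydrodynamic limit holds for the small-amplitude members δ < δ₁ of
such a family. V (FieldVarianceBound):
tested fields keep CLT-size fluctuations, (N+1)·Var ≤ C, uniformly along C¹ pre-shock families. C′
(AnalyticPreShockPathsR, pure PDE, PACKING-GUARDED since the
2026-08-16 Statement re-type p126922; it supersedes the unguarded AnalyticPreShockPaths, flagged
misstated by six refuters): for some packing
threshold η₀ > 0 (outermost — it becomes the Statement's η₀), every classical hs-Euler solution
whose local packing ρ_s(x)σ³ stays below η₀ on
[0,T) and every t < T admit a family of classical solutions on [0,T') ∋ t joining a constant state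
(δ = 0) to it
(δ = 1), with data real-analytic in (δ,x) on [0,1) and jointly C¹ up to δ = 1. Vitali on sub-paths
[0,δ₂], δ₂ ↑ 1, plus equicontinuity at
δ = 1 paid by V, turn B into the limit at δ = 1; Chebyshev with V gives convergence in probability.
Lean: `UniformAmplitudeAnalyticity ∧ NearEquilibriumLimit ∧ FieldVarianceBound ∧
AnalyticPreShockPathsR`

## Assembly
Pure logic, and it IS the deciding theorem `closes` (rev 5, route-repair 2026-08-16): `closes h₁ h₂
h₃ h₄ h₅ h₆ := h₆ h₁ h₂ h₃ h₄ h₅` — the GUARDED transfer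
AmplitudeTransferR (support; candidate proof kernel-checked in the planner folder,
CheckTransferR.lean, axioms propext / Classical.choice / Quot.sound,
attached as evidence) applied to UniformAmplitudeAnalyticity, NearEquilibriumLimit,
FieldVarianceBound, AnalyticPreShockPathsR and the PROVED
LocalGibbsStatics yields the re-typed, packing-guarded sub-problem Statement
`_root_.HydrodynamicLimit` BY NAME: C′'s threshold η₀ is offered as the
Statement's and the Statement's guard ∀ t < T ∀ x, ρ_t(x)σ³ < η₀ is handed verbatim to C′. All
mathematics of the Vitali transfer (steps (1)–(5)) lives in
the transfer item, not in `closes`. History: revs 0–3 concluded the then root abbrev through the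
unguarded transfer AmplitudeTransfer (PROVED,
amplitudeTransfer_proof); rev 4 (interim, same day) post-composed it with
`HydrodynamicLimit.of_unguarded`, discarding the guard.

Rationale: WHY THIS LINE. Mechanism: complex analyticity in the AMPLITUDE of the initial local-Gibbs tilt, with
the invariant canonical Gibbs law as base point, and
Vitali's theorem as the engine carrying identification of the limit from near to far from
equilibrium — the dynamical twin of the static
transfer of Penrose1963 / LebowitzPenrose1968 / Ruelle1969 §5.1 (proof of Thm 5.1.3: N-uniformly
bounded, convergent for small real activity ⇒
convergent on the whole zero-free region), run on Spohn1991 §7.1 (7.16)–(7.18) BACKWARDS (Spohn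
differentiates the local-equilibrium
expectation in the tilt at 0 and interchanges ε → 0 with ∂_λ without proof; A is exactly the
N-uniformity licensing all such interchanges,
to all orders and up to amplitude O(1)). Imported areas: one-complex-variable normal families
(Montel, Vitali–Porter, identity theorem —
all proved in `Literature.Analysis.Complex`: Conway1978 VII.2.9), Lee–Yang zero-free regions
(LeeYang1952, Ruelle1969 Thm 4.2.3) and
canonical-ensemble cluster expansions for the statics (PulvirentiTsagkarogiannis2012,
arXiv:1409.2718), hyperbolic-PDE analytic dependence
and lifespan (AlinhacMetivier1984, Kato1975, Majda1984, Sideris1985); the physics of the Euler-scale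
cumulants behind B is ballistic
macroscopic fluctuation theory (DoyonEtAl2023, arXiv:2506.05266) and Spohn2014. Versus the board:
every other open route estimates the
non-equilibrium law at δ = 1 directly (relative entropy, cumulants of P_t, compactness + weak–strong
uniqueness, vanishing noise, mixing);
CramerEdgeLadder climbs REAL mesoscopic amplitudes by moderate deviations; this line never estimates
P_t at δ = 1 — it asks for an
N-uniform zero-free region plus a near-equilibrium theorem (OllaVaradhanYau1993 and Yau1991 are
entropy methods; TothValko2003 treats
Euler-scale limits of stochastic systems, not transfer). The three HydrodynamicLimit negatives
(stmt-9168, 9236, 9238) concern adjoint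
Enskog test families and sub-population carving and are not touched.

RANKED CRUXES. #2 UniformAmplitudeAnalyticity (crux) — (card A1, weakest sufficient form) For
profile bounds B ≥ 1 there is σ₀(B) such that for σ < σ₀, every path of local-Gibbs profiles (a, u,
θ)_δ jointly real-analytic in (δ, x) on [0,1] × 𝕋³ (through Torus.stLift) within the bounds, every
family of classical hs-Euler solutions on [0,T') LLN-matched to it at time 0 for all δ ∈ [0,1] (with
the laws probability measures), every flow family, every t < T' and every continuous one-body
observable w with |w(x,v)| ≤ C_w(1+|v|²): there are r > 0 and M such that for every N the mean δ ↦
E_ψ_δ^N[∫ w dμ^emp(Φ^N_t z)] is the restriction to [0,1] of a holomorphic function bounded by M on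
the r-neighbourhood of [0,1] ⊂ ℂ. At t = 0, or for w = |v|², v, 1 (conserved), this is
canonical-ensemble statics (zero-freeness of the canonical partition function in a complex activity
profile at low density); at t > 0 it is the card's "no dynamical Lee–Yang zeros before the shock".
[difficulty: open-problem] (why it might fail: An N-uniform COMPLEX-tilt large-deviation bound over
≍N^(1/3) collision times: a real pinch of zeros of δ ↦ E_G[e^Λ(δ) W∘Φ_t] (dynamical phase
transition, hidden slow mode) before T' kills it; unknown even for OVY-noisy gases or stochastic
lattice gases with proved HDL.) [Ruelle1969, LeeYang1952, LebowitzPenrose1968, Penrose1963,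
Spohn1991, DoyonEtAl2023, PulvirentiTsagkarogiannis2012, OllaVaradhanYau1993]
#3 NearEquilibriumLimit (crux) — (card B1') Same frame as UniformAmplitudeAnalyticity plus constant
profiles at δ = 0 (global equilibrium): there is δ₁ > 0 such that for every δ ∈ [0, δ₁) and every t
< T' the empirical density, momentum and energy fields at time t converge in probability
(TendstoHydroFieldsAt) under ψ_δ^N to the matched classical Euler solution — the conjunct restricted
to small-amplitude analytic perturbations of global equilibrium on bounded pre-shock time windows.
[difficulty: open-problem] (why it might fail: Still a hydrodynamic limit for deterministic hard
spheres: needs decay over ≍N^(1/3) collision times of the non-hydrodynamic part of a small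
perturbation of Gibbs (no spectral/linear-response theorem for the N-body Liouvillian at fixed σ;
Spohn1991 (7.13) open); a hidden slow mode breaks it.) [Spohn1991, OllaVaradhanYau1993, Yau1991,
TothValko2003, DoyonEtAl2023, Spohn2014]
#4 FieldVarianceBound (crux) — For profile bounds B ≥ 1 there is σ₀(B) such that for σ < σ₀, along
every path of profiles jointly C¹ in (δ, x) on [0,1] × 𝕋³ within the bounds, with a family of
classical solutions on [0,T') LLN-matched for all δ (laws probability measures) and, for the t ∈
[0,T') at hand, jointly C¹ in (δ, s, x) on [0,1] × [0,t] × 𝕋³: for every growth constant C_w there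
is C with (N+1)·eVar_ψ_δ^N(∫ w dμ^emp(Φ^N_t z)) ≤ C for all continuous w with |w| ≤ C_w(1+|v|²), all
N and all δ ∈ [0,1] — CLT-size fluctuations of one-body empirical observables persist to Euler
times, uniformly along compact C¹ pre-shock families (at t = 0 or δ = 0 this is statics, by
invariance of the canonical Gibbs law). Used three times by the transfer: mean convergence from B,
equi-Lipschitz means in δ via d/dδ m_N = (N+1)·Cov, Chebyshev at δ = 1. [difficulty: open-problem]
(why it might fail: For δ > 0 no change-of-measure argument survives (dψ_δ/dG ~ e^(O(δN))); an
Euler-background instability amplifying thermal noise beyond N^(-1/2), or anomalous growth of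
dynamical correlations at fixed σ, breaks the O(1/N) variance; unknown beyond equilibrium for any
deterministic gas.) [Spohn1991, OllaVaradhanYau1993, BoldrighiniDobrushinSukhov1983, DoyonEtAl2023,
arXiv:1409.2718]
#5 AnalyticPreShockPathsR (crux) — (repaired C, PACKING-GUARDED; route-repair 2026-08-16 after the
Statement re-type p126922, adopting verbatim the repair C′ endorsed by six refuters on stmt-11873) ∃
η₀ > 0 OUTERMOST such that for data bounds B ≥ 1 there is σ₀(B) with, for σ < σ₀: every classical
hs-Euler solution on [0,T) with data in [1/B, B], ∫ρ(0) = 1 AND local packing ρ_s(x)σ³ < η₀ for all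
s < T (the Statement's own guard), and every t < T, admit T' ∈ (t, T] and a family of classical
solutions on [0,T'), δ ∈ [0,1]: member 1 = the input, constant data at 0, unit mass + bounds 2B,
data real-analytic in (δ, x) on [0,1) × 𝕋³, tested fields δ-analytic on [0,1) ∀ s < T', jointly C¹
on [0,1] × [0,t] × 𝕋³. The guard keeps the input and the δ → 1⁻ members in the dilute band where
hsPressure is analytic and the system symmetric hyperbolic (Dafermos2005 Thm 5.1.1, Kato1975,
Majda1984; AlinhacMetivier1984 for δ-analyticity); what remains is pre-shock path-connectivity in
the 2B box. [difficulty: L] (why it might fail: Pre-shock path-connectivity is unprinted for 3-D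
compressible Euler: focusing can push the lifespan below t, or an intermediate member out of the
dilute band, along every analytic path in the 2B box from a constant to U(0); δ-analyticity up to t
needs control of the complexified flow.) [AlinhacMetivier1984, Kato1975, Majda1984, Dafermos2005,
Sideris1985, Christodoulou2008, MerleEtAl2022, BuckmasterCaolaboraGomezserrano2025]
#9 LocalGibbsStatics (support) — Low-density statics of the canonical local Gibbs laws of the
conjunct (strengthens the Literature fact localGibbs_lln with IDENTIFICATION of the limit): for
bounds B ≥ 1 and σ < σ₀(B) there are the local equation of state R = R_σ (density as a function of
activity for the homogeneous hard-sphere gas; Ruelle1969 Thm 4.2.3) and its inverse, both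
real-analytic and within [z/2, 2z] on [0, 4B²] resp. [0, 2B], R strictly increasing, R(0) = 0, such
that for continuous profiles (a, θ₀, u₀) within the bounds there is a chemical potential μ with
∫R(e^μ a) = 1, the laws are probability measures for all N and flows (library:
isProbabilityMeasure_localGibbsLaw for σ ≤ 1/2), and the three empirical fields at time 0 converge
in probability to (R(e^μ a(x)), u₀, θ₀) (LLN with the LOCAL equation of state; canonical cluster
expansion in inhomogeneous activity, PulvirentiTsagkarogiannis2012, LebowitzPenrose1964, Ruelle1969
Ch. 4; conditionally Gaussian velocities as in HardSphereEulerProofs). [difficulty: L] [Ruelle1969,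
LebowitzPenrose1964, PulvirentiTsagkarogiannis2012, Spohn1991, Georgii1994]
#9 AmplitudeTransfer (support) — THE TRANSFER — glue of the deciding theorem, no open mathematics,
Lean-heavy: A → B → V → C → S → HydrodynamicLimit (Literature decl; the root abbrev by defeq). Proof
plan. (1) Fix continuous positive profiles with two-sided bound B₀; S(B₃), B₃ = 16B₀², identifies
the data of any LLN-matched classical solution: ρ(0) = R(e^μ a₀), u(0) = u₀, θ(0) = θ₀ (two limits
in probability of the same variables under probability measures agree; continuous functions with
equal integrals against all continuous χ coincide), so ∫ρ(0) = 1 and data bounds B₁ = 4B₀²; σ₀ :=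
min of the σ₀'s of S(B₃), C(B₁), A(B₃), B(B₃), V(B₃). (2) For σ < σ₀, a solution on [0,T), flows Φ,
matching at 0 and t < T: C gives T' ∈ (t,T] and the family; the path a_δ := Rinv ∘ ρ^δ(0), θ_δ :=
θ^δ(0), u_δ := u^δ(0) is analytic on [0,1) × 𝕋³, C¹ on [0,1] × 𝕋³, constant at 0, within B₃,
LLN-matched for every δ by S (μ_δ = 0 by strict monotonicity of μ ↦ ∫R(e^μ a_δ)), and a_1 = e^μ a₀,
so ψ[a_1,u₀,θ₀] = ψ[a₀,u₀,θ₀] (canonicalDensity is invariant under a ↦ c·a: c^(N+1) cancels against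
canonicalPartition). (3) For each δ₂ < 1 the reparametrised sub-path δ ↦ (·)_(δ₂δ) satisfies the
frames of A, B, V: A gives holomorphic g_N bounded by M on the convex open thickening U of [0,1]
with g_N = m_N on [0,1]; B (δ < δ₁) with V (eVar ≤ C/(N+1) ⇒ means converge) gives g_N(δ) → Euler
value on (0,δ₁); the library's Vitali theorem
(exists_tendstoLocallyUniformlyOn_of_frequently_tendsto: U open preconnected, local bound M,
pointwise convergence frequently near δ₁/2) gives a holomorphic limit G; the identity theorem on a
real interval ⊃ [0,1] (AnalyticOnNhd.eqOn_of_preconnected_of_eventuallyEq) against the δ-analytic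
tested Euler fields of C identifies G: m_N(δ') → Euler value for every δ' < 1, for w = χ, χ·v_i,
χ|v|²/2. (4) Endpoint: d/dδ m_N = (N+1)·Cov_ψ_δ(W∘Φ_t, Π̄_δ), Π̄_δ the empirical average of the
δ-derivative of the one-body log-density (continuous, quadratic velocity growth, path C¹), is
bounded uniformly in N by V at times t and 0 (Cauchy–Schwarz), so m_N is equi-Lipschitz on [0,1];
with continuity in δ at 1 of the tested Euler fields (C, joint C¹) m_N(1) → Euler value at δ = 1,
i.e. for (ρ, u, θ)(t). (5) V at δ = 1 and Chebyshev (meas_ge_le_evariance_div_sq), coordinatewise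
for the momentum field (ContinuousLinearMap.integral_comp_comm), give TendstoHydroFieldsAt under
ψ[a₀,u₀,θ₀] at time t. Helper lemmas (differentiation of E_ψ_δ under the integral, scaling
invariance of canonicalDensity, strict monotonicity of the mass constraint) ride with --supports
AmplitudeTransfer. [difficulty: L] [Ruelle1969, Conway1978, Spohn1991, OllaVaradhanYau1993,
BenfattoGiulianiMastropietro2006]
#9 AmplitudeTransferR (support) — THE GUARDED TRANSFER A → B → V → C′ → S → _root_.HydrodynamicLimit
(the re-typed registry def, by name). PROVABLE NOW: candidate proof kernel-checked in the planner
folder and attached as evidence (CheckTransferR.lean, rc 0, axioms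
propext/Classical.choice/Quot.sound) = amplitudeTransfer_proof with three edits (take η₀ from C′ and
offer it as the Statement's; intro the Statement's guard after hsol; hand it to C′); the 13 helper
modules of AmplitudeTransfer are reused unchanged. [difficulty: S] [Ruelle1969, Conway1978,
Spohn1991, OllaVaradhanYau1993]
#9 AnalyticPreShockPaths (support since rev 5; SUPERSEDED by C′) — the unguarded original: time-0
data bounds only, so the joint-C¹ clause drags the δ → 1⁻ members through every packing the input
visits and 3-D implosion makes those unbounded — misstated / unprovable as typed per six refuters +
grounder (no ¬S). Off the deciding path; kept as a decl because the PROVED AmplitudeTransfer names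
it; not to be staffed. [MerleEtAl2022]

TWO-LAYER PLAN. Foreseen glued splits (none filed now; k ≤ 3, depth 1). NearEquilibriumLimit ⇐
EquilibriumCumulantIdentification (card B1: for every k the
k-th δ-derivative at 0 of the means — an EQUILIBRIUM (k+1)-point time-displaced cumulant under the
invariant Gibbs law — converges to the
k-th Euler/BMFT response; k = 0 statics, k = 1 Spohn1991 (7.18) Landau–Placzek at Euler scale, k ≥ 2
tree responses, DoyonEtAl2023,
arXiv:2506.05266) → UniformAmplitudeAnalyticity near δ = 0 → NearEquilibriumLimit, the glue being
the PROVED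
`Literature.Analysis.Complex.tendsto_of_forall_tendsto_taylorCoeff` (convergence of a uniformly
bounded analytic family from its Taylor
coefficients) plus V. UniformAmplitudeAnalyticity ⇐ StaticZeroFree (canonical Lee–Yang:
zero-freeness and N-uniform bounds of the canonical
partition function in a complex activity PROFILE at low density, t = 0;
PulvirentiTsagkarogiannis2012-type expansion) → KineticTimeAnalyticity
(t ≤ c·(N+1)^(-1/3): finitely many collisions per particle, dynamical cluster expansion at fixed σ)
→ the macroscopic-time statement (the
real crux; glue = a semigroup/restart property in the complex amplitude, if any).
AnalyticPreShockPathsR ⇐ AnalyticDependence (analytic data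
path with inf T* > t inside the dilute band ⇒ δ-analytic, jointly C¹ classical family;
AlinhacMetivier1984 + Kato1975/Majda1984/Dafermos2005) → PreShockConnectivity (the set of
smooth data within bounds whose classical lifespan exceeds t with packing below η₀ on [0,t] contains
a C¹ path from a constant state to U(0); for Burgers T* = 1/max(−u₀′)
makes it star-shaped about 0) → AnalyticPreShockPathsR.

KILL CRITERIA. Refutation of UniformAmplitudeAnalyticity for some analytic pre-shock path (an
N-uniform lower bound showing the δ-radius of m_N shrinks to 0 at
a macroscopic time before any shock, or a proof that the time-t large-deviation rate function of a
tested field under analytic local Gibbs data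
is non-analytic pre-shock) closes the route: `close --reason refuted:UniformAmplitudeAnalyticity`.
¬NearEquilibriumLimit (a near-equilibrium
counterexample to the hydrodynamic limit) refutes the CONJUNCT near equilibrium — file
¬HydrodynamicLimitFor and alert every route.
¬FieldVarianceBound with the conjunct still plausible (super-CLT fluctuations pre-shock) forces a
pivot: replace V by exponential
concentration from κ-analyticity of the space-time pressure (card (A1) strong form) or by entropy
bounds. ¬AnalyticPreShockPathsR (for every threshold η₀: a guarded classical
solution whose data cannot be joined to a constant inside {T* > t} ∩ {packing < η₀ on [0,t]}) forces
a pivot to the weaker theorem "Euler up to T_path = inf_δ T*(δ)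
along the amplitude segment" (new item with T_path; the conjunct's arbitrary T is then out of reach
of this line alone). A misstatement found
in AmplitudeTransferR is repaired by a new glue item + re-certified `closes`, never by weakening a
crux (precedent: the 2026-08-16 repair C → C′ followed the
Statement re-type, it did not weaken the route's claim relative to the Statement).
NearEquilibriumLimit proved elsewhere
(CramerEdgeLadder's ladder, FirstFailureBlowup-type small-data theorems) is consumed;
HydrodynamicLimit proved by any route moots everything.

NOT DECOMPOSED YET. First, the LANDING of AmplitudeTransferR (provable now: candidate proof
CheckTransferR.lean attached as evidence — amplitudeTransfer_proof plus three
guard-threading edits; until it lands the route is draft under the crux-only rule and serves it as a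
glue obligation). Then: the strong form (A1) of the card (zero-freeness and two-sided e^(±NM) bounds
of the space-time moment generating function
(δ, κ) ↦ E_ψ_δ[e^(κ(N+1)W∘Φ_t)] on a complex polydomain, which would also give exponential
concentration and make V redundant) — filed only if
V dies; the equilibrium cumulant tower B1 (layer-2 children of NearEquilibriumLimit); the
kinetic-time (t ≲ (N+1)^(-1/3)) version of A and
its static t = 0 slice (canonical Lee–Yang); an OVY-noise / stochastic-lattice-gas rung of A (the
triage's "honest first rung": A is unknown
even where HDL is a theorem — needs definitions of those dynamics, not filed); HsEosLowDensity-type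
analyticity of hsExcessFreeEnergy (inside
the proofs of C and S; shared item stmt-AtomisticToContinuum-0768 of other routes, attachable with
--supports); the helper lemmas of
AmplitudeTransfer (differentiation of canonical local Gibbs expectations in δ = (N+1)·covariance,
scaling invariance of canonicalDensity,
Bochner/evariance bookkeeping, coordinatewise momentum field); the shock-time = Lee–Yang-edge
prediction (not load-bearing).

CHEAPEST FALSIFIER. (i) Pen and paper: Burgers / p-system caricature — for ANALYTIC data the tested
entropy-free solution is δ-analytic on a complex neighbourhood
of [0,1] of width ≍ r_x/(c·t) (r_x = x-analyticity radius) and not beyond; done for Burgers by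
characteristics (analytic in δ iff data or test
function analytic — consistent with A being stated on (δ,x)-analytic paths only). (ii) kit MD (not
run: hub compute-free for planners):
equilibrium hard spheres at ρσ³ = 0.05, N = 10³–10⁵: finite-size scaling of N²κ₃(W_t; Λ, Λ) for a
sinusoidal tilt observable Λ at t = O(1) —
growth with N kills A; (N+1)·Var_ψ_δ(W_t) at δ = 0.5 vs N — growth kills V. (iii) Lookup: a printed
dynamical Lee–Yang/Fisher-zero result
pinching the real TILT axis at finite macroscopic time for a reversible deterministic or OVY-noisy
gas (searched again this session: none;
Blythe–Evans zeros are in model parameters of driven steady states, Flindt–Garrahan in counting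
fields, Heyl et al. in complex time).

NUMBERS. Static zero-free radius (Ruelle1969 Thm 4.2.3, hard core): |z| < e^(-1) C(β)^(-1), C =
(4π/3)d³ for spheres of diameter d — in the conjunct's
units the activity radius is ≍ 0.088/σ³, huge for σ < σ₀, which is why σ₀(B) exists in A and S at t
= 0. Second virial coefficient:
Z(η) = 1 + (2π/3)η + O(η²) (HardSphereEuler.lean; Ruelle1969 §4.3). Collisions per particle per unit
macroscopic time ≍ (N+1)^(1/3)
(HardSphereEuler.lean). Lifespan of amplitude-δ smooth periodic data ≳ 1/δ (Kato1975/Majda1984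
continuation; Sideris1985 finiteness in 3-D).
Probability-measure guard: isProbabilityMeasure_localGibbsLaw needs σ ≤ 1/2 (HardSphereEulerProofs).
Items at open: 7 (4 cruxes, 2 support,
1 assembly; no separate target decl — X is the conjunction of the four cruxes and the gate renders
targets before cruxes). Items after the 2026-08-16 repair: 9 — cruxes A, B, V, C′ (ranks 2–5);
supports LocalGibbsStatics ✓, AmplitudeTransfer ✓, AmplitudeTransferR (provable now),
AnalyticPreShockPaths (superseded); Assembly (the rev-2 crux chain through the
old C, provable by `of_unguarded ∘ amplitudeTransfer_proof`, not load-bearing). Packing guard: the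
Statement's `∃ η₀` is C′'s.

DEFINITION REQUESTS. None needed to type the items: localGibbsLaw, TendstoHydroFieldsAt,
IsHardSphereEulerSolution, empiricalMeasure, Torus.stLift/proj, hsDiameter,
ProbabilityTheory.evariance, Metric.thickening exist; complex tilts are avoided by stating analytic
EXTENSIONS of real-δ means (unique by the
identity theorem), cumulants by evariance/covariance at finite N. Vitali/Montel are library theorems
(Literature.Analysis.Complex.VitaliConvergence,
.Montel, .BoundedAnalyticFamilyLimit). A later definition `spaceTimeMGF`
(Summits/AtomisticToContinuum/HydrodynamicLimit/Theorems) would shorten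
the strong form (A1) if it is ever filed.

Novelty: Searches (2026-08-15, this session): `lit frontier AtomisticToContinuum --since 2021` (30 rows: DHM
follow-ups, Bose gases, crystallization,
arXiv:2310.13338 heat equation from deterministic dynamics; nothing on amplitude analyticity); `lit
search --source zbmath` "Lee-Yang zeros
nonequilibrium" (5: doi:10.1103/physrevlett.89.080601 Blythe–Evans, doi:10.1088/0305-4470/37/15/001
— zeros in model parameters of driven
steady states, not data amplitude, not hydrodynamic), "analytic dependence hydrodynamic limit
initial data" (0 relevant), "cluster expansion
canonical ensemble" (15: PulvirentiTsagkarogiannis2012, arXiv:1409.2718, arXiv:2005.13931,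
arXiv:2603.25592 — statics, sources for S and the
t = 0 slice of A), "Vitali theorem thermodynamic limit correlation functions analyticity" (0),
"linear response time correlation analyticity
coupling" (0); `lit search --source arxiv` "Euler scale correlation … ballistic macroscopic
fluctuation theory" (1: arXiv:2506.05266), "zeros
partition function complex external field canonical ensemble" (0); `lit galaxy search --star all` ×3
("analytic in the strength of the initial
perturbation" 0, "Vitali's theorem hydrodynamic" 0, "dynamical Lee-Yang zeros" 1 irrelevant pdf);
`lit search --hybrid` local (vector leg only:
generic textbook pages, Gaspard2022 p.105, Dorfman1999 p.144 — nothing on amplitude analyticity);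
OpenAlex/S2 rate-limited (429), searchd rc 75
once; `lean search` found Vitali/Montel/Taylor-coefficient transfer PROVED in Literat  [refs: 10.1103/physrevlett.89.080601, 10.1088/0305-4470/37/15/001, 10.1103/physreve.88.012119, 10.1007/bf01388563, 2310.13338, 1409.2718, 2005.13931, 2603.25592, 2506.05266, 2206.14167, 2504.09201, 1209.2524, 1206.2505, doi:10.1103/physrevlett.89.080601, doi:10.1088/0305-4470/37/15/001, doi:10.1103/physreve.88.012119, doi:10.1007/bf01388563, PulvirentiTsagkarogiannis2012, Gaspard2022, Dorfman1999, Alinha]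

Barriers (technique_class: amplitude-analyticity vitali-transfer dynamical-lee-yang): - technique_class: amplitude-analyticity vitali-transfer dynamical-lee-yang
- Literature.Barriers.AtomisticToContinuum.BoltzmannHypothesisBarrier: evaded in form — no
classification of stationary states of the infinite dynamics is used; the only stationary law is the
finite-N canonical Gibbs law (base point of the tilt family), whose invariance is a theorem.
Conceded in substance: the ergodic content reappears inside NearEquilibriumLimit (relaxation of
small perturbations of Gibbs) and UniformAmplitudeAnalyticity; the barrier's ideal-gas kernel is
respected (free flight satisfies A but not B — velocity laws do not relax — so the line proves
nothing there, as it must).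
- Literature.Barriers.AtomisticToContinuum.MacroErgodicityBarrier: the same concession — B and A
carry the relaxation content; no hypothesis on infinite-volume invariant measures is assumed
anywhere.
- Literature.Barriers.AtomisticToContinuum.NoDensityExpansionBarrier: not met — no expansion in the
density and no term-by-term t → ∞ limit of isolated-group dynamics; the expansion variable is the
tilt amplitude at FIXED σ, Euler scale carries no transport coefficients, and the Two-layer plan
states that no smoothness-blind cluster expansion can prove A at macroscopic times (the δ-radius
must see the x-analyticity radius).
- Literature.Barriers.AtomisticToContinuum.DiluteRegimeBarrier: not met — (N+1)ε³ = σ³ fixed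
throughout, full hs equation of state via LocalGibbsStatics/R_σ; σ₀(B) small and, since the
2026-08-16

History (route lifecycle, newest last):
- 2026-08-16T17:54:07Z · rev 2: restated Assembly (stmt-AtomisticToContinuum-11876 proved) — @note.txt (planner-rground-AtomisticToContinuum-VitaliAmpl-029d45fb-0)
- 2026-08-23T05:14:32Z · DORMANT — reconciler: no traction for 5.9 d (last activity item-evidence-added at 2026-08-17T06:25:25Z); parked, not closed — `ledger route dormant route-AtomisticToConti (operator:999:3773148)

sub-problem: HydrodynamicLimit · status: dormant · opened planner-plancard-AtomisticToContinuum-Hydrody-8a105f44-g2-0 2026-08-15T18:45:31Z · rev 7 · ledger route-AtomisticToContinuum-VitaliAmplitudeTransfer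
GENERATED by the gate from the ledger (D-0016/17). Provers cite these decls: `theorem foo : Summit.AtomisticToContinuum.HydrodynamicLimit.Theses.VitaliAmplitudeTransfer.<Decl> := …` in Summits/AtomisticToContinuum/HydrodynamicLimit/Theorems/<Name>.lean.
-/

namespace Summit.AtomisticToContinuum.HydrodynamicLimit.Theses.VitaliAmplitudeTransfer

open scoped BigOperators Topology Manifold Classical MeasureTheory ProbabilityTheory Matrix InnerProductSpace ComplexConjugate ContinuousMap
open Filter Set Function TopologicalSpace MeasureTheory

attribute [summit_statement] _root_.HydrodynamicLimit

/-- item stmt-AtomisticToContinuum-11870 · crux · rank 2 · open · by planner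
why it might fail: An N-uniform COMPLEX-tilt large-deviation bound over ≍N^(1/3) collision times: a real pinch of zeros of δ ↦ E_G[e^Λ(δ) W∘Φ_t] (dynamical phase transition, hidden slow mode) before T' kills it; unknown even for OVY-noisy gases or stochastic lattice gases with proved HDL.
sources: Ruelle1969, LeeYang1952, LebowitzPenrose1968, Penrose1963, Spohn1991, DoyonEtAl2023
[crux] (card A1, weakest sufficient form) For profile bounds B ≥ 1 there is σ₀(B) such that for σ <
σ₀, every path of local-Gibbs profiles (a, u, θ)_δ jointly real-analytic in (δ, x) on [0,1] × 𝕋³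
(through Torus.stLift) within the bounds, every family of classical hs-Euler solutions on [0,T')
LLN-matched to it at time 0 for all δ ∈ [0,1] (with the laws probability measures), every flow
family, every t < T' and every continuous one-body observable w with |w(x,v)| ≤ C_w(1+|v|²): there
are r > 0 and M such that for every N the mean δ ↦ E_ψ_δ^N[∫ w dμ^emp(Φ^N_t z)] is the restriction
to [0,1] of a holomorphic function bounded by M on the r-neighbourhood of [0,1] ⊂ ℂ. At t = 0, or
for w = |v|², v, 1 (conserved), this is canonical-ensemble statics (zero-freeness of the canonical
partition function in a complex activity profile at low density); at t > 0 it is the card's "no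
dynamical Lee–Yang zeros before the shock". [difficulty: open-problem] -/
@[route_item "route-AtomisticToContinuum-VitaliAmplitudeTransfer", crux]
def UniformAmplitudeAnalyticity : Prop :=
  ∀ B : ℝ, 1 ≤ B → ∃ σ₀ : ℝ, 0 < σ₀ ∧ ∀ σ : ℝ, 0 < σ → σ < σ₀ → ∀ (a θp : ℝ → Literature.MathematicalPhysics.KineticTheory.T3 → ℝ) (up : ℝ → Literature.MathematicalPhysics.KineticTheory.T3 → Literature.MathematicalPhysics.KineticTheory.V3), AnalyticOnNhd ℝ (Literature.Analysis.FunctionSpaces.Torus.stLift a) (Set.Icc 0 1 ×ˢ Set.univ) → AnalyticOnNhd ℝ (Literature.Analysis.FunctionSpaces.Torus.stLift θp) (Set.Icc 0 1 ×ˢ Set.univ) → AnalyticOnNhd ℝ (Literature.Analysis.FunctionSpaces.Torus.stLift up) (Set.Icc 0 1 ×ˢ Set.univ) → (∀ δ ∈ Set.Icc (0:ℝ) 1, ∀ x, B⁻¹ ≤ a δ x ∧ a δ x ≤ B ∧ B⁻¹ ≤ θp δ x ∧ θp δ x ≤ B ∧ ‖up δ x‖ ≤ B) → ∀ (T' : ℝ)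 (ρE θE : ℝ → ℝ → Literature.MathematicalPhysics.KineticTheory.T3 → ℝ) (uE : ℝ → ℝ → Literature.MathematicalPhysics.KineticTheory.T3 → Literature.MathematicalPhysics.KineticTheory.V3), (∀ δ ∈ Set.Icc (0:ℝ) 1, Literature.MathematicalPhysics.KineticTheory.IsHardSphereEulerSolution σ T' (ρE δ) (uE δ) (θE δ)) → ∀ Φ : (N : ℕ) → Literature.Analysis.FluidPDE.HardSphereFlow (Literature.Analysis.FluidPDE.Torus.geometry (Fin 3)) (Literature.MathematicalPhysics.KineticTheory.hsDiameter σ N) (N + 1), (∀ δ ∈ Set.Icc (0:ℝ) 1, (∀ N, MeasureTheory.IsProbabilityMeasure (Literature.MathematicalPhysics.KineticTheory.localGibbsLaw σ (a δ) (up δ) (θp δ) N (Φ N))) ∧ Literature.MathematicalPhysics.KineticTheory.TendstoHydroFieldsAt (fun N => Literature.MathematicalPhysics.KineticTheory.localGibbsLaw σ (a δ) (up δ) (θp δ) N (Φ N)) Φ (ρE δ) (uE δ) (θE δ) 0) → ∀ t ∈ Set.Ico 0 T', ∀ w : Literature.MathematicalPhysics.KineticTheory.T3 × Literature.MathematicalPhysics.KineticTheory.V3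 → ℝ, Continuous w → (∃ Cw : ℝ, ∀ y, |w y| ≤ Cw * (1 + ‖y.2‖ ^ 2)) → ∃ r : ℝ, 0 < r ∧ ∃ M : ℝ, ∀ N : ℕ, ∃ g : ℂ → ℂ, DifferentiableOn ℂ g (Metric.thickening r (Complex.ofReal '' Set.Icc (0:ℝ) 1)) ∧ (∀ ζ ∈ Metric.thickening r (Complex.ofReal '' Set.Icc (0:ℝ) 1), ‖g ζ‖ ≤ M) ∧ ∀ δ ∈ Set.Icc (0:ℝ) 1, g (δ : ℂ) = ((∫ z, (∫ y, w y ∂(Literature.Analysis.FluidPDE.empiricalMeasure ((Φ N).flow t z))) ∂(Literature.MathematicalPhysics.KineticTheory.localGibbsLaw σ (a δ) (up δ) (θp δ) N (Φ N)) : ℝ) : ℂ)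

/-- item stmt-AtomisticToContinuum-11871 · crux · rank 3 · open · by planner
why it might fail: Still a hydrodynamic limit for deterministic hard spheres: needs decay over ≍N^(1/3) collision times of the non-hydrodynamic part of a small perturbation of Gibbs (no spectral/linear-response theorem for the N-body Liouvillian at fixed σ; Spohn1991 (7.13) open); a hidden slow mode breaks it.
sources: Spohn1991, OllaVaradhanYau1993, Yau1991, TothValko2003, DoyonEtAl2023, Spohn2014
[crux] (card B1') Same frame as UniformAmplitudeAnalyticity plus constant profiles at δ = 0 (global
equilibrium): there is δ₁ > 0 such that for every δ ∈ [0, δ₁) and every t < T' the empirical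
density, momentum and energy fields at time t converge in probability (TendstoHydroFieldsAt) under
ψ_δ^N to the matched classical Euler solution — the conjunct restricted to small-amplitude analytic
perturbations of global equilibrium on bounded pre-shock time windows. [difficulty: open-problem] -/
@[route_item "route-AtomisticToContinuum-VitaliAmplitudeTransfer", crux]
def NearEquilibriumLimit : Prop :=
  ∀ B : ℝ, 1 ≤ B → ∃ σ₀ : ℝ, 0 < σ₀ ∧ ∀ σ : ℝ, 0 < σ → σ < σ₀ → ∀ (a θp : ℝ → Literature.MathematicalPhysics.KineticTheory.T3 → ℝ) (up : ℝ → Literature.MathematicalPhysics.KineticTheory.T3 → Literature.MathematicalPhysics.KineticTheory.V3), AnalyticOnNhd ℝ (Literature.Analysis.FunctionSpaces.Torus.stLift a) (Set.Icc 0 1 ×ˢ Set.univ) → AnalyticOnNhd ℝ (Literature.Analysis.FunctionSpaces.Torus.stLift θp) (Set.Icc 0 1 ×ˢ Set.univ) → AnalyticOnNhd ℝ (Literature.Analysis.FunctionSpaces.Torus.stLift up) (Set.Icc 0 1 ×ˢ Set.univ) → (∀ δ ∈ Set.Icc (0:ℝ) 1, ∀ x, B⁻¹ ≤ a δ x ∧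 a δ x ≤ B ∧ B⁻¹ ≤ θp δ x ∧ θp δ x ≤ B ∧ ‖up δ x‖ ≤ B) → (∀ x y, a 0 x = a 0 y ∧ θp 0 x = θp 0 y ∧ up 0 x = up 0 y) → ∀ (T' : ℝ) (ρE θE : ℝ → ℝ → Literature.MathematicalPhysics.KineticTheory.T3 → ℝ) (uE : ℝ → ℝ → Literature.MathematicalPhysics.KineticTheory.T3 → Literature.MathematicalPhysics.KineticTheory.V3), (∀ δ ∈ Set.Icc (0:ℝ) 1, Literature.MathematicalPhysics.KineticTheory.IsHardSphereEulerSolution σ T' (ρE δ) (uE δ) (θE δ)) → ∀ Φ : (N : ℕ) → Literature.Analysis.FluidPDE.HardSphereFlow (Literature.Analysis.FluidPDE.Torus.geometry (Fin 3)) (Literature.MathematicalPhysics.KineticTheory.hsDiameter σ N) (N + 1), (∀ δ ∈ Set.Icc (0:ℝ) 1, (∀ N, MeasureTheory.IsProbabilityMeasure (Literature.MathematicalPhysics.KineticTheory.localGibbsLaw σ (a δ) (up δ) (θp δ) N (Φ N))) ∧ Literature.MathematicalPhysics.KineticTheory.TendstoHydroFieldsAt (fun N => Literature.MathematicalPhysics.KineticTheory.localGibbsLaw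 σ (a δ) (up δ) (θp δ) N (Φ N)) Φ (ρE δ) (uE δ) (θE δ) 0) → ∃ δ₁ : ℝ, 0 < δ₁ ∧ ∀ δ ∈ Set.Ico (0:ℝ) δ₁, ∀ t ∈ Set.Ico 0 T', Literature.MathematicalPhysics.KineticTheory.TendstoHydroFieldsAt (fun N => Literature.MathematicalPhysics.KineticTheory.localGibbsLaw σ (a δ) (up δ) (θp δ) N (Φ N)) Φ (ρE δ) (uE δ) (θE δ) t

/-- item stmt-AtomisticToContinuum-11872 · crux · rank 4 · open · by planner
why it might fail: For δ > 0 no change-of-measure argument survives (dψ_δ/dG ~ e^(O(δN))); an Euler-background instability amplifying thermal noise beyond N^(-1/2), or anomalous growth of dynamical correlations at fixed σ, breaks the O(1/N) variance; unknown beyond equilibrium for any deterministic gas.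
sources: Spohn1991, OllaVaradhanYau1993, BoldrighiniDobrushinSukhov1983, DoyonEtAl2023, arXiv:1409.2718
[crux] For profile bounds B ≥ 1 there is σ₀(B) such that for σ < σ₀, along every path of profiles
jointly C¹ in (δ, x) on [0,1] × 𝕋³ within the bounds, with a family of classical solutions on [0,T')
LLN-matched for all δ (laws probability measures) and, for the t ∈ [0,T') at hand, jointly C¹ in (δ,
s, x) on [0,1] × [0,t] × 𝕋³: for every growth constant C_w there is C with (N+1)·eVar_ψ_δ^N(∫ w
dμ^emp(Φ^N_t z)) ≤ C for all continuous w with |w| ≤ C_w(1+|v|²), all N and all δ ∈ [0,1] — CLT-size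
fluctuations of one-body empirical observables persist to Euler times, uniformly along compact C¹
pre-shock families (at t = 0 or δ = 0 this is statics, by invariance of the canonical Gibbs law).
Used three times by the transfer: mean convergence from B, equi-Lipschitz means in δ via d/dδ m_N =
(N+1)·Cov, Chebyshev at δ = 1. [difficulty: open-problem] -/
@[route_item "route-AtomisticToContinuum-VitaliAmplitudeTransfer", crux]
def FieldVarianceBound : Prop :=
  ∀ B : ℝ, 1 ≤ B → ∃ σ₀ : ℝ, 0 < σ₀ ∧ ∀ σ : ℝ, 0 < σ → σ < σ₀ → ∀ (a θp : ℝ → Literature.MathematicalPhysics.KineticTheory.T3 → ℝ) (up : ℝ → Literature.MathematicalPhysics.KineticTheory.T3 → Literature.MathematicalPhysics.KineticTheory.V3), ContDiffOn ℝ 1 (Literature.Analysis.FunctionSpaces.Torus.stLift a) (Set.Icc 0 1 ×ˢ Set.univ) → ContDiffOn ℝ 1 (Literature.Analysis.FunctionSpaces.Torus.stLift θp) (Set.Icc 0 1 ×ˢ Set.univ) → ContDiffOn ℝ 1 (Literature.Analysis.FunctionSpaces.Torus.stLift up) (Set.Icc 0 1 ×ˢ Set.univ) → (∀ δ ∈ Set.Icc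 (0:ℝ) 1, ∀ x, B⁻¹ ≤ a δ x ∧ a δ x ≤ B ∧ B⁻¹ ≤ θp δ x ∧ θp δ x ≤ B ∧ ‖up δ x‖ ≤ B) → ∀ (T' : ℝ) (ρE θE : ℝ → ℝ → Literature.MathematicalPhysics.KineticTheory.T3 → ℝ) (uE : ℝ → ℝ → Literature.MathematicalPhysics.KineticTheory.T3 → Literature.MathematicalPhysics.KineticTheory.V3), (∀ δ ∈ Set.Icc (0:ℝ) 1, Literature.MathematicalPhysics.KineticTheory.IsHardSphereEulerSolution σ T' (ρE δ) (uE δ) (θE δ)) → ∀ Φ : (N : ℕ) → Literature.Analysis.FluidPDE.HardSphereFlow (Literature.Analysis.FluidPDE.Torus.geometry (Fin 3)) (Literature.MathematicalPhysics.KineticTheory.hsDiameter σ N) (N + 1), (∀ δ ∈ Set.Icc (0:ℝ) 1, (∀ N, MeasureTheory.IsProbabilityMeasure (Literature.MathematicalPhysics.KineticTheory.localGibbsLaw σ (a δ) (up δ) (θp δ) N (Φ N))) ∧ Literature.MathematicalPhysics.KineticTheory.TendstoHydroFieldsAt (fun N => Literature.MathematicalPhysics.KineticTheory.localGibbsLaw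 σ (a δ) (up δ) (θp δ) N (Φ N)) Φ (ρE δ) (uE δ) (θE δ) 0) → ∀ t ∈ Set.Ico 0 T', ContDiffOn ℝ 1 (fun p : ℝ × ℝ × EuclideanSpace ℝ (Fin 3) => ρE p.1 p.2.1 (Literature.Analysis.FunctionSpaces.Torus.proj p.2.2)) (Set.Icc 0 1 ×ˢ Set.Icc 0 t ×ˢ Set.univ) → ContDiffOn ℝ 1 (fun p : ℝ × ℝ × EuclideanSpace ℝ (Fin 3) => θE p.1 p.2.1 (Literature.Analysis.FunctionSpaces.Torus.proj p.2.2)) (Set.Icc 0 1 ×ˢ Set.Icc 0 t ×ˢ Set.univ) → ContDiffOn ℝ 1 (fun p : ℝ × ℝ × EuclideanSpace ℝ (Fin 3) => uE p.1 p.2.1 (Literature.Analysis.FunctionSpaces.Torus.proj p.2.2)) (Set.Icc 0 1 ×ˢ Set.Icc 0 t ×ˢ Set.univ) → ∀ Cw : ℝ, ∃ C : ℝ, ∀ w : Literature.MathematicalPhysics.KineticTheory.T3 × Literature.MathematicalPhysics.KineticTheory.V3 → ℝ, Continuous w → (∀ y, |w y| ≤ Cw * (1 + ‖y.2‖ ^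 2)) → ∀ N : ℕ, ∀ δ ∈ Set.Icc (0:ℝ) 1, ((N : ENNReal) + 1) * ProbabilityTheory.evariance (fun z => ∫ y, w y ∂(Literature.Analysis.FluidPDE.empiricalMeasure ((Φ N).flow t z))) (Literature.MathematicalPhysics.KineticTheory.localGibbsLaw σ (a δ) (up δ) (θp δ) N (Φ N)) ≤ ENNReal.ofReal C

/-- item stmt-AtomisticToContinuum-17806 · crux · rank 5 · open · by planner
why it might fail: Pre-shock path-connectivity is unprinted for 3-D compressible Euler: focusing can push the lifespan below t, or an intermediate member out of the dilute band, along every analytic path in the 2B box from a constant to U(0); δ-analyticity up to t needs control of the complexified flow.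
sources: AlinhacMetivier1984, Kato1975, Majda1984, Dafermos2005, Sideris1985, Christodoulou2008
[crux] (repaired AnalyticPreShockPaths — card C1 + pre-shock connectivity, pure PDE,
PACKING-GUARDED; route-repair 2026-08-16 after the Statement re-type p126922 and the standing
refuted-misstated finding on stmt-AtomisticToContinuum-11873, six refuters and the grounder
concurring, their repair C′ adopted verbatim) There is a packing threshold η₀ > 0 (OUTERMOST; the
prover picks it inside the analyticity band of the hard-sphere equation of state) such that for data
bounds B ≥ 1 there is σ₀(B) with, for σ < σ₀: for every classical hs-Euler solution (ρ, u, θ) on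
[0,T) WHOSE LOCAL PACKING STAYS BELOW η₀ — ∀ s ∈ [0,T), ∀ x, ρ_s(x)σ³ < η₀, the sub-problem's own
guard, handed down verbatim by the guarded transfer AmplitudeTransferR — with data in [1/B, B] and
∫ρ(0) = 1, and for every t < T, there are T' ∈ (t, T] and a family (ρ^δ, u^δ, θ^δ), δ ∈ [0,1], of
classical solutions on [0,T') with: member δ = 1 equal to (ρ, u, θ) on [0,T'); constant data at δ =
0; unit mass and data bounds 2B for all δ; data jointly real-analytic in (δ, x) on [0,1) × 𝕋³;
tested fields ∫χρ^δ(s), ∫χρ^δu^δ(s), ∫χE^δ(s) real-analytic in δ on [0,1) for every s < T' and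
continuous χ; the family jointly C¹ in (δ, s, x) -/
@[route_item "route-AtomisticToContinuum-VitaliAmplitudeTransfer", crux]
def AnalyticPreShockPathsR : Prop :=
  ∃ η₀ : ℝ, 0 < η₀ ∧ ∀ B : ℝ, 1 ≤ B → ∃ σ₀ : ℝ, 0 < σ₀ ∧ ∀ σ : ℝ, 0 < σ → σ < σ₀ → ∀ (T : ℝ) (ρ θ : ℝ → Literature.MathematicalPhysics.KineticTheory.T3 → ℝ) (u : ℝ → Literature.MathematicalPhysics.KineticTheory.T3 → Literature.MathematicalPhysics.KineticTheory.V3), Literature.MathematicalPhysics.KineticTheory.IsHardSphereEulerSolution σ T ρ u θ → (∀ s ∈ Set.Ico 0 T, ∀ x, ρ s x * σ ^ 3 < η₀) → (∀ x, B⁻¹ ≤ ρ 0 x ∧ ρ 0 x ≤ B ∧ B⁻¹ ≤ θ 0 x ∧ θ 0 x ≤ B ∧ ‖u 0 x‖ ≤ B) → (∫ x, ρ 0 x = 1) → ∀ t ∈ Set.Ico 0 T, ∃ T' : ℝ, t < T' ∧ T' ≤ T ∧ ∃ (ρE θE : ℝ → ℝ → Literature.MathematicalPhysics.KineticTheory.T3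 → ℝ) (uE : ℝ → ℝ → Literature.MathematicalPhysics.KineticTheory.T3 → Literature.MathematicalPhysics.KineticTheory.V3), (∀ δ ∈ Set.Icc (0:ℝ) 1, Literature.MathematicalPhysics.KineticTheory.IsHardSphereEulerSolution σ T' (ρE δ) (uE δ) (θE δ)) ∧ (∀ s ∈ Set.Ico 0 T', ρE 1 s = ρ s ∧ uE 1 s = u s ∧ θE 1 s = θ s) ∧ (∀ x y, ρE 0 0 x = ρE 0 0 y ∧ uE 0 0 x = uE 0 0 y ∧ θE 0 0 x = θE 0 0 y) ∧ (∀ δ ∈ Set.Icc (0:ℝ) 1, (∫ x, ρE δ 0 x = 1) ∧ ∀ x, (2 * B)⁻¹ ≤ ρE δ 0 x ∧ ρE δ 0 x ≤ 2 * B ∧ (2 * B)⁻¹ ≤ θE δ 0 x ∧ θE δ 0 x ≤ 2 * B ∧ ‖uE δ 0 x‖ ≤ 2 * B) ∧ AnalyticOnNhd ℝ (Literature.Analysis.FunctionSpaces.Torus.stLift (fun δ => ρE δ 0)) (Set.Ico 0 1 ×ˢ Set.univ) ∧ AnalyticOnNhd ℝ (Literature.Analysis.FunctionSpaces.Torus.stLift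 (fun δ => θE δ 0)) (Set.Ico 0 1 ×ˢ Set.univ) ∧ AnalyticOnNhd ℝ (Literature.Analysis.FunctionSpaces.Torus.stLift (fun δ => uE δ 0)) (Set.Ico 0 1 ×ˢ Set.univ) ∧ (∀ s ∈ Set.Ico 0 T', ∀ χ : Literature.MathematicalPhysics.KineticTheory.T3 → ℝ, Continuous χ → AnalyticOnNhd ℝ (fun δ => ∫ x, χ x * ρE δ s x) (Set.Ico 0 1) ∧ AnalyticOnNhd ℝ (fun δ => ∫ x, (χ x * ρE δ s x) • uE δ s x) (Set.Ico 0 1) ∧ AnalyticOnNhd ℝ (fun δ => ∫ x, χ x * Literature.MathematicalPhysics.KineticTheory.totalEnergyDensity (ρE δ s x) (uE δ s x) (θE δ s x)) (Set.Ico 0 1)) ∧ ContDiffOn ℝ 1 (fun p : ℝ × ℝ × EuclideanSpace ℝ (Fin 3) => ρE p.1 p.2.1 (Literature.Analysis.FunctionSpaces.Torus.proj p.2.2)) (Set.Icc 0 1 ×ˢ Set.Icc 0 t ×ˢ Set.univ) ∧ ContDiffOn ℝ 1 (fun p : ℝ × ℝ × EuclideanSpace ℝ (Fin 3) => θE p.1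 p.2.1 (Literature.Analysis.FunctionSpaces.Torus.proj p.2.2)) (Set.Icc 0 1 ×ˢ Set.Icc 0 t ×ˢ Set.univ) ∧ ContDiffOn ℝ 1 (fun p : ℝ × ℝ × EuclideanSpace ℝ (Fin 3) => uE p.1 p.2.1 (Literature.Analysis.FunctionSpaces.Torus.proj p.2.2)) (Set.Icc 0 1 ×ˢ Set.Icc 0 t ×ˢ Set.univ)

/-- item stmt-AtomisticToContinuum-11873 · support · rank 5 · open · by planner
why it might fail: Needs a C¹ path from U(0) to a constant INSIDE the open set {T* > t} ∩ {bounds 2B}: amplitude scaling can shorten the lifespan (focusing), so pre-shock connectivity is a real question; δ-analyticity up to any t < inf T* needs analytic data and control of the complexified flow.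
sources: AlinhacMetivier1984, Kato1975, Majda1984, Sideris1985, Christodoulou2008
[crux] (card C1 + path connectivity, pure PDE) For data bounds B ≥ 1 there is σ₀(B) such that for σ
< σ₀: for every classical hs-Euler solution (ρ, u, θ) on [0,T) with data in [1/B, B] and ∫ρ(0) = 1
and every t < T there are T' ∈ (t, T] and a family (ρ^δ, u^δ, θ^δ), δ ∈ [0,1], of classical
solutions on [0,T') with: member δ = 1 equal to (ρ, u, θ) on [0,T'); constant data at δ = 0; unit
mass and data bounds 2B for all δ; data jointly real-analytic in (δ, x) on [0,1) × 𝕋³; tested fields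
∫χρ^δ(s), ∫χρ^δu^δ(s), ∫χE^δ(s) real-analytic in δ on [0,1) for every s < T' and continuous χ; and
the family jointly C¹ in (δ, s, x) on [0,1] × [0,t] × 𝕋³ (σ₀(B) only keeps ρσ³ inside the analytic
low-density branch of the equation of state, where the system is symmetric hyperbolic). [difficulty:
L] -/
@[route_item "route-AtomisticToContinuum-VitaliAmplitudeTransfer"]
def AnalyticPreShockPaths : Prop :=
  ∀ B : ℝ, 1 ≤ B → ∃ σ₀ : ℝ, 0 < σ₀ ∧ ∀ σ : ℝ, 0 < σ → σ < σ₀ → ∀ (T : ℝ) (ρ θ : ℝ → Literature.MathematicalPhysics.KineticTheory.T3 → ℝ) (u : ℝ → Literature.MathematicalPhysics.KineticTheory.T3 → Literature.MathematicalPhysics.KineticTheory.V3), Literature.MathematicalPhysics.KineticTheory.IsHardSphereEulerSolution σ T ρ u θ → (∀ x, B⁻¹ ≤ ρ 0 x ∧ ρ 0 x ≤ B ∧ B⁻¹ ≤ θ 0 x ∧ θ 0 x ≤ B ∧ ‖u 0 x‖ ≤ B) → (∫ x, ρ 0 x = 1) → ∀ t ∈ Set.Ico 0 T, ∃ T' :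 ℝ, t < T' ∧ T' ≤ T ∧ ∃ (ρE θE : ℝ → ℝ → Literature.MathematicalPhysics.KineticTheory.T3 → ℝ) (uE : ℝ → ℝ → Literature.MathematicalPhysics.KineticTheory.T3 → Literature.MathematicalPhysics.KineticTheory.V3), (∀ δ ∈ Set.Icc (0:ℝ) 1, Literature.MathematicalPhysics.KineticTheory.IsHardSphereEulerSolution σ T' (ρE δ) (uE δ) (θE δ)) ∧ (∀ s ∈ Set.Ico 0 T', ρE 1 s = ρ s ∧ uE 1 s = u s ∧ θE 1 s = θ s) ∧ (∀ x y, ρE 0 0 x = ρE 0 0 y ∧ uE 0 0 x = uE 0 0 y ∧ θE 0 0 x = θE 0 0 y) ∧ (∀ δ ∈ Set.Icc (0:ℝ) 1, (∫ x, ρE δ 0 x = 1) ∧ ∀ x, (2 * B)⁻¹ ≤ ρE δ 0 x ∧ ρE δ 0 x ≤ 2 * B ∧ (2 * B)⁻¹ ≤ θE δ 0 x ∧ θE δ 0 x ≤ 2 * B ∧ ‖uE δ 0 x‖ ≤ 2 * B) ∧ AnalyticOnNhd ℝ (Literature.Analysis.FunctionSpaces.Torus.stLift (fun δ => ρE δ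 0)) (Set.Ico 0 1 ×ˢ Set.univ) ∧ AnalyticOnNhd ℝ (Literature.Analysis.FunctionSpaces.Torus.stLift (fun δ => θE δ 0)) (Set.Ico 0 1 ×ˢ Set.univ) ∧ AnalyticOnNhd ℝ (Literature.Analysis.FunctionSpaces.Torus.stLift (fun δ => uE δ 0)) (Set.Ico 0 1 ×ˢ Set.univ) ∧ (∀ s ∈ Set.Ico 0 T', ∀ χ : Literature.MathematicalPhysics.KineticTheory.T3 → ℝ, Continuous χ → AnalyticOnNhd ℝ (fun δ => ∫ x, χ x * ρE δ s x) (Set.Ico 0 1) ∧ AnalyticOnNhd ℝ (fun δ => ∫ x, (χ x * ρE δ s x) • uE δ s x) (Set.Ico 0 1) ∧ AnalyticOnNhd ℝ (fun δ => ∫ x, χ x * Literature.MathematicalPhysics.KineticTheory.totalEnergyDensity (ρE δ s x) (uE δ s x) (θE δ s x)) (Set.Ico 0 1)) ∧ ContDiffOn ℝ 1 (fun p : ℝ × ℝ × EuclideanSpace ℝ (Fin 3) => ρE p.1 p.2.1 (Literature.Analysis.FunctionSpaces.Torus.proj p.2.2)) (Set.Icc 0 1 ×ˢ Set.Icc 0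 t ×ˢ Set.univ) ∧ ContDiffOn ℝ 1 (fun p : ℝ × ℝ × EuclideanSpace ℝ (Fin 3) => θE p.1 p.2.1 (Literature.Analysis.FunctionSpaces.Torus.proj p.2.2)) (Set.Icc 0 1 ×ˢ Set.Icc 0 t ×ˢ Set.univ) ∧ ContDiffOn ℝ 1 (fun p : ℝ × ℝ × EuclideanSpace ℝ (Fin 3) => uE p.1 p.2.1 (Literature.Analysis.FunctionSpaces.Torus.proj p.2.2)) (Set.Icc 0 1 ×ˢ Set.Icc 0 t ×ˢ Set.univ)

/-- item stmt-AtomisticToContinuum-11874 · support · rank 9 · closed · proved by Summit.AtomisticToContinuum.HydrodynamicLimit.Theorems.localGibbsStatics_proof @ 4af2c4d4b598 (prover) · by planner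
sources: Ruelle1969, LebowitzPenrose1964, PulvirentiTsagkarogiannis2012, Spohn1991, Georgii1994
[support] Low-density statics of the canonical local Gibbs laws of the conjunct (strengthens the
Literature fact localGibbs_lln with IDENTIFICATION of the limit): for bounds B ≥ 1 and σ < σ₀(B)
there are the local equation of state R = R_σ (density as a function of activity for the homogeneous
hard-sphere gas; Ruelle1969 Thm 4.2.3) and its inverse, both real-analytic and within [z/2, 2z] on
[0, 4B²] resp. [0, 2B], R strictly increasing, R(0) = 0, such that for continuous profiles (a, θ₀,
u₀) within the bounds there is a chemical potential μ with ∫R(e^μ a) = 1, the laws are probability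
measures for all N and flows (library: isProbabilityMeasure_localGibbsLaw for σ ≤ 1/2), and the
three empirical fields at time 0 converge in probability to (R(e^μ a(x)), u₀, θ₀) (LLN with the
LOCAL equation of state; canonical cluster expansion in inhomogeneous activity,
PulvirentiTsagkarogiannis2012, LebowitzPenrose1964, Ruelle1969 Ch. 4; conditionally Gaussian
velocities as in HardSphereEulerProofs). [difficulty: L] -/
@[route_item "route-AtomisticToContinuum-VitaliAmplitudeTransfer", crux]
def LocalGibbsStatics : Prop :=
  ∀ B : ℝ, 1 ≤ B → ∃ σ₀ : ℝ, 0 < σ₀ ∧ ∀ σ : ℝ, 0 < σ → σ < σ₀ → ∃ R Rinv : ℝ → ℝ, AnalyticOnNhd ℝ R (Set.Icc 0 (4 * B ^ 2)) ∧ AnalyticOnNhd ℝ Rinv (Set.Icc 0 (4 * B ^ 2)) ∧ StrictMonoOn R (Set.Icc 0 (4 * B ^ 2)) ∧ R 0 = 0 ∧ (∀ z ∈ Set.Icc (0:ℝ) (4 * B ^ 2), Rinv (R z) = z ∧ z / 2 ≤ R z ∧ R z ≤ 2 * z) ∧ (∀ y ∈ Set.Icc (0:ℝ) (2 * B), R (Rinv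 y) = y ∧ y / 2 ≤ Rinv y ∧ Rinv y ≤ 2 * y) ∧ ∀ (a θ₀ : Literature.MathematicalPhysics.KineticTheory.T3 → ℝ) (u₀ : Literature.MathematicalPhysics.KineticTheory.T3 → Literature.MathematicalPhysics.KineticTheory.V3), Continuous a → Continuous θ₀ → Continuous u₀ → (∀ x, B⁻¹ ≤ a x ∧ a x ≤ B ∧ B⁻¹ ≤ θ₀ x ∧ θ₀ x ≤ B ∧ ‖u₀ x‖ ≤ B) → ∃ μ : ℝ, (∫ x, R (Real.exp μ * a x) = 1) ∧ (∀ x, Real.exp μ * a x ∈ Set.Icc (0:ℝ) (4 * B ^ 2)) ∧ ∀ Φ : (N : ℕ) → Literature.Analysis.FluidPDE.HardSphereFlow (Literature.Analysis.FluidPDE.Torus.geometry (Fin 3)) (Literature.MathematicalPhysics.KineticTheory.hsDiameter σ N) (N + 1), (∀ N, MeasureTheory.IsProbabilityMeasure (Literature.MathematicalPhysics.KineticTheory.localGibbsLaw σ a u₀ θ₀ N (Φ N))) ∧ Literature.MathematicalPhysics.KineticTheory.TendstoHydroFieldsAt (fun N => Literature.MathematicalPhysics.KineticTheory.localGibbsLaw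 σ a u₀ θ₀ N (Φ N)) Φ (fun _ x => R (Real.exp μ * a x)) (fun _ => u₀) (fun _ => θ₀) 0

/-- item stmt-AtomisticToContinuum-11875 · support · rank 9 · closed · proved by Summit.AtomisticToContinuum.HydrodynamicLimit.Theorems.amplitudeTransfer_proof @ 7b96f1ca095d (prover) · by planner
sources: Ruelle1969, Conway1978, Spohn1991, OllaVaradhanYau1993, BenfattoGiulianiMastropietro2006
[support] THE TRANSFER — glue of the deciding theorem, no open mathematics, Lean-heavy: A → B → V →
C → S → HydrodynamicLimit (Literature decl; the root abbrev by defeq). Proof plan. (1) Fix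
continuous positive profiles with two-sided bound B₀; S(B₃), B₃ = 16B₀², identifies the data of any
LLN-matched classical solution: ρ(0) = R(e^μ a₀), u(0) = u₀, θ(0) = θ₀ (two limits in probability of
the same variables under probability measures agree; continuous functions with equal integrals
against all continuous χ coincide), so ∫ρ(0) = 1 and data bounds B₁ = 4B₀²; σ₀ := min of the σ₀'s of
S(B₃), C(B₁), A(B₃), B(B₃), V(B₃). (2) For σ < σ₀, a solution on [0,T), flows Φ, matching at 0 and t
< T: C gives T' ∈ (t,T] and the family; the path a_δ := Rinv ∘ ρ^δ(0), θ_δ := θ^δ(0), u_δ := u^δ(0)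
is analytic on [0,1) × 𝕋³, C¹ on [0,1] × 𝕋³, constant at 0, within B₃, LLN-matched for every δ by S
(μ_δ = 0 by strict monotonicity of μ ↦ ∫R(e^μ a_δ)), and a_1 = e^μ a₀, so ψ[a_1,u₀,θ₀] = ψ[a₀,u₀,θ₀]
(canonicalDensity is invariant under a ↦ c·a: c^(N+1) cancels against canonicalPartition). (3) For
each δ₂ < 1 the reparametrised sub-path δ ↦ (·)_(δ₂δ) satisfies the frames of A, B, V: A gives
holomorphic g_N -/
@[route_item "route-AtomisticToContinuum-VitaliAmplitudeTransfer"]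
def AmplitudeTransfer : Prop :=
  UniformAmplitudeAnalyticity → NearEquilibriumLimit → FieldVarianceBound → AnalyticPreShockPaths → LocalGibbsStatics → Literature.MathematicalPhysics.KineticTheory.HydrodynamicLimit

/-- item stmt-AtomisticToContinuum-17807 · support · rank 9 · closed · proved by Summit.AtomisticToContinuum.HydrodynamicLimit.Theorems.amplitudeTransferR_proof @ 49a43c259d05 (prover) · by planner
sources: Ruelle1969, Conway1978, Spohn1991, OllaVaradhanYau1993
[support] THE GUARDED TRANSFER (route-repair 2026-08-16, after the Statement re-type p126922):
UniformAmplitudeAnalyticity → NearEquilibriumLimit → FieldVarianceBound → AnalyticPreShockPathsR →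
LocalGibbsStatics → _root_.HydrodynamicLimit (the packing-guarded registry def, BY NAME). PROVABLE
NOW — candidate proof kernel-checked in the planner folder (CheckTransferR.lean: lean check rc 0, 0
sorries, #print axioms = propext / Classical.choice / Quot.sound; attached as evidence on this
item): it is `amplitudeTransfer_proof` (Theorems/VitaliAmplitudeTransferAmplitudeTransfer.lean; its
13 helper modules — PathConstruction, EquiLipschitz, Transfer, Identification, … — reused unchanged)
with THREE edits: `obtain ⟨η₀, hη₀, hC⟩ := hCR; refine ⟨η₀, hη₀, ?_⟩` before `intro a₀ θ₀ u₀ …`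
(C′'s threshold is offered as the Statement's), `intro T ρ θ u hsol hguard Φ hLLN t ht` (the
Statement's guard), and `hC' σ hσ hσC' T ρ θ u hsol hguard hdata hmass1 t ht` (the guard handed to
C′). Land it as Theorems/VitaliAmplitudeTransferAmplitudeTransferR.lean: the check file minus its
two local defs. Steps (1)–(5) of the transfer are exactly those of AmplitudeTransfer (identification
of the data by S; the pa -/
@[route_item "route-AtomisticToContinuum-VitaliAmplitudeTransfer", crux]
def AmplitudeTransferR : Prop :=
  UniformAmplitudeAnalyticity → NearEquilibriumLimit → FieldVarianceBound → AnalyticPreShockPathsR → LocalGibbsStatics → _root_.HydrodynamicLimit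

-- earlier Assembly (stmt-AtomisticToContinuum-11876, replaced 2026-08-16T17:54:07Z -> stmt-AtomisticToContinuum-16171): proved by Summit.AtomisticToContinuum.HydrodynamicLimit.Theorems.vitaliAmplitudeTransfer_assembly_proof @ 4120aa6a37d9 — UniformAmplitudeAnalyticity → NearEquilibriumLimit → FieldVarianceBound → AnalyticPreShockPaths → LocalGibbsStatics → AmplitudeTransfer → _root_.HydrodynamicLimi
/-- item stmt-AtomisticToContinuum-16171 · assembly · rank 1 · closed · proved by Summit.AtomisticToContinuum.HydrodynamicLimit.Theorems.vitaliAmplitudeTransfer_assembly_proof @ 44eec5ab6514 (prover) · by planner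
sources: Ruelle1969, Spohn1991, OllaVaradhanYau1993
[assembly] RESTATED for ground (route-repair 2026-08-16): the CRUX-ONLY chain
UniformAmplitudeAnalyticity → NearEquilibriumLimit → FieldVarianceBound → AnalyticPreShockPaths →
HydrodynamicLimit (conclusion = the sub-problem Statement decl `_root_.HydrodynamicLimit`). The two
supports are no longer antecedents: LocalGibbsStatics and AmplitudeTransfer are PROVED (Theorems:
localGibbsStatics_proof, amplitudeTransfer_proof) and are discharged inside the proof — this item is
closable at once by `fun h₁ h₂ h₃ h₄ => amplitudeTransfer_proof h₁ h₂ h₃ h₄ localGibbsStatics_proof`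
in a Theorems file importing VitaliAmplitudeTransferAmplitudeTransfer and
VitaliAmplitudeTransferLocalGibbsStatics (checked in the planner folder, CheckProof.lean rc 0). The
earlier form listed the glue AmplitudeTransfer among its own antecedents and was modus ponens
(ground.trivial by `intros; aesop`); the deciding theorem `closes` is unchanged (it keeps the two
proved supports as hypotheses so that the route's closure is modulo the four cruxes only). -/
@[route_item "route-AtomisticToContinuum-VitaliAmplitudeTransfer"]
def Assembly : Prop :=
  UniformAmplitudeAnalyticity → NearEquilibriumLimit → FieldVarianceBound → AnalyticPreShockPaths → _root_.HydrodynamicLimit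

/-! D-0027 §2.1 — DECIDING THEOREM (planner-authored via `route open/edit --closes-file`; by planner-rbadge-AtomisticToContinuum-VitaliAmpl-029d45fb-0 2026-08-16T23:55:02Z):
its hypotheses are this route's items and its conclusion the sub-problem Statement (glue_lint), and it elaborates with this file. -/

@[closes "route-AtomisticToContinuum-VitaliAmplitudeTransfer"] theorem closes (h₁ : UniformAmplitudeAnalyticity) (h₂ : NearEquilibriumLimit) (h₃ : FieldVarianceBound)
    (h₄ : AnalyticPreShockPathsR) (h₅ : LocalGibbsStatics) (h₆ : AmplitudeTransferR) :
    _root_.HydrodynamicLimit :=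
  h₆ h₁ h₂ h₃ h₄ h₅

end Summit.AtomisticToContinuum.HydrodynamicLimit.Theses.VitaliAmplitudeTransfer
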